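import Literature.Computability.FineGrained.OVFromSETHSplitInstance
import HarnessLib

/-!
# SETH ⇒ OV: the word-RAM program of Williams' split-and-list reduction

The program behind the named fact `sparseKSATInRAMTime_of_ov_subquadratic` of
`…FineGrained.OVFromSETH` (R. Williams, TCS 348 (2005), §5.1, Thm. 5.1; V. Vassilevska Williams,
Proc. ICM 2018, §3, proof of Thm. 3.1: a truly subquadratic OV algorithm in dimension `c log N`
decides sparse `k`-SAT in time `2^{(1-ε/2) n}`), written — exactly like the grouping reduction of
`…CliqueETHReductionProgram`, whose toolkit and conventions it reuses — as structured word-RAM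
code (`SProg` of `…WordRAMStructured`, verified in the logic `SProg.Achieves` of
`…WordRAMAchieves`) around one emulated run of the hypothetical OV program (`SProg.withSubrun` of
`…WordRAMSubrun`), and the proof that its *build* phase computes, in closed form, the memory
presenting the OV encoding of the split instance (`OVRed.splitOV` of `…OVFromSETHSplitInstance`)
to the emulator. The run, the word-size and time analysis, and the proof of the named fact are in
`…OVFromSETHProofs`.

* **The program** (`OVRed.pre c kM cM`, `OVRed.reduction`): relocate the input
  (`SProg.relocate`); compute `n, m, h = ⌈n/2⌉, N = 2^h, d = c h, N d`, the base `Bv` of the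
  emulated cells and `2 N d + 2` (`setup1`); the emulated word size `ws = kM · size (2 N d + 2)` by
  the halving loop `CliqueRed.sizeLoop` and the emulator's environment registers (`setup3`); the
  header `2 N d + 2, N, d` of the emulated input (`header`); the `N` rows of the first side and the
  `N` rows of the second side (`rowsA`, `rowsB`), each row by one sequential pass over the encoded
  clauses (`rowPass`: for every clause, the disjunction over its literals of "the literal lies on
  this side and the assignment word makes it true" is accumulated with the overflow-free
  `eq`/`band`/`lt` only, and the negated bit, reduced modulo `2^ws`, is written to the emulated
  cell of the clause); clear the scratch registers (`CliqueRed.clearRegs`); after the emulated run,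
  `CliqueRed.post` copies the OV program's answer bit to the output.
* **Ghost parameters** (`OVRed.Params` with `x, Lx, X, n, m, h, N, d, Nd, Bv, ws, Pw, V, Sv, env`),
  the run requirements `Params.Fits W`, and the intended memory contents stage by stage
  (`ycell`, `fillData`, `finData`, `finMem`).
* **Verification**, phase by phase (`setup1_spec`, `setup3_spec`, `header_spec`, `litLoop_spec`,
  `clauseBody_spec`, `rowPass_spec`, `rowsA_spec`, `rowsB_spec`), and finally **`Params.pre_spec`**:
  on the initial memory of `x = encodeCNFWords φ` (word size `W` with `Fits W`, width `≤ k`) the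
  build ends within `Params.Tpre k` steps in exactly the memory `Params.finMem`.

## References

* R. Williams, *A new algorithm for optimal 2-constraint satisfaction and its implications*,
  Theoret. Comput. Sci. 348 (2005) 357–365, §5.1 (Thm. 5.1; Theorem 5 of the author's version).
* V. Vassilevska Williams, *On some fine-grained questions in algorithms and complexity*,
  Proc. ICM 2018, §2 (the word RAM; algorithms calling an algorithm for another problem), §3
  (proof of Thm. 3.1).
* T. Nipkow, G. Klein, *Concrete Semantics with Isabelle/HOL*, Springer 2014, §12 (verification
  of `WHILE` programs by invariants).
-/


namespace Literature.Computability.FineGrained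

open Cryptography Cryptography.WordRAM Complexity Cryptography.WordRAM.SProg

namespace OVRed

open CliqueRed (r pt im lay achieves_block_of_eq)
open SplitList (half satW half_le le_two_mul_half)

/-! ### Register map

`0 = X` (base of the relocated input, `x[j]` in cell `X + j`), `1 = D = X - 1` (set by `relocate`);
`2 = n`, `3 = m`, `4 = h`, `5 = N = 2^h`, `6 = d = c h`, `7 = N d`; the emulator's layout
(`CliqueRed.lay`) `10 = Bv`, `11 = Sv`, `12 = Gv (= 0)`, `13 = Pw = 2^ws`, temporaries `14, 15, 16`;
`17` post; scratch `20–29, 33` (setup, header, row pass), `30–32` (assignment word, side, row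
base), `40, 41` (row loops). -/

/-! ### Setup: the constants -/

/-- Setup, part 1: `n, m, h = (n + 1) / 2, N = 2^h, d = h c, N d, Bv = X + Lx`, then
`r21 := 2 N d + 2`, `r22 := 0`. [folklore] -/
def setup1 (c : ℕ) : SProg := block [
  (.band, r 2, pt 0, pt 0),
  (.add, r 20, r 0, im 1), (.band, r 3, pt 20, pt 20),
  (.add, r 4, r 2, im 1), (.shr, r 4, r 4, im 1),
  (.shl, r 5, im 1, r 4),
  (.mul, r 6, r 4, im c),
  (.mul, r 7, r 5, r 6),
  (.sub, r 20, r 1, im 100), (.add, r 10, r 1, r 20), (.add, r 10, r 10, im 1),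
  (.mul, r 21, r 7, im 2), (.add, r 21, r 21, im 2), (.band, r 22, im 0, im 0)]

/-- Setup, part 3: `ws := kM · size`, `Pw := 2^ws`, and `r23 := max (Pw - 1) (max cM (2 N d + 2))`
(`cM` the largest constant of the OV program), `Sv := Bv + r23 + 1`, `Gv := 0` (verbatim the
`setup3` of `CliqueRed` with `2 N d + 2` for `N² + 2`). [folklore] -/
def setup3 (kM cM : ℕ) : SProg := seqs [
  block [(.mul, r 22, r 22, im kM), (.shl, r 13, im 1, r 22), (.sub, r 23, r 13, im 1),
    (.lt, r 24, r 23, im cM)],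
  ifz (r 24) skip (block [(.band, r 23, im cM, im cM)]),
  block [(.mul, r 25, r 7, im 2), (.add, r 25, r 25, im 2), (.lt, r 24, r 23, r 25)],
  ifz (r 24) skip (block [(.band, r 23, r 25, r 25)]),
  block [(.add, r 11, r 10, r 23), (.add, r 11, r 11, im 1), (.band, r 12, im 0, im 0)]]

/-! ### The header of the emulated input -/

/-- The header: emulated cells `0, 1, 2` hold `2 N d + 2`, `N`, `d` (mod `Pw`). [folklore] -/
def header : SProg := block [
  (.mul, r 20, r 7, im 2), (.add, r 20, r 20, im 2), (.mod, r 20, r 20, r 13),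
  (.band, pt 10, r 20, r 20),
  (.mod, r 20, r 5, r 13), (.add, r 21, r 10, im 1), (.band, pt 21, r 20, r 20),
  (.mod, r 20, r 6, r 13), (.add, r 21, r 10, im 2), (.band, pt 21, r 20, r 20)]

/-! ### One row: a pass over the clauses -/

/-- Row pass, one literal (code in `mem[r20]`) of the current clause: OR into `r25` the bit
"the literal's side (`[var < h]`) is the row's side `r31` and bit `var` of the assignment word
`r30` is its polarity" (disjunction of bits `a`, `b` as `[[a = 0] ∧ [b = 0] < 1]`, using only the
overflow-free operations `eq`, `band`, `lt`); advance. [folklore] -/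
def litBody : SProg := block [
  (.band, r 26, pt 20, pt 20),
  (.shr, r 27, r 26, im 1),
  (.band, r 28, r 26, im 1),
  (.lt, r 29, r 27, r 4), (.eq, r 29, r 29, r 31),
  (.shr, r 33, r 30, r 27), (.band, r 33, r 33, im 1), (.eq, r 33, r 33, r 28),
  (.band, r 29, r 29, r 33),
  (.eq, r 33, r 25, im 0), (.eq, r 29, r 29, im 0), (.band, r 33, r 33, r 29),
  (.lt, r 25, r 33, im 1),
  (.add, r 20, r 20, im 1), (.sub, r 23, r 23, im 1)]

/-- Row pass, one clause `q = r21`: read its length, process its literals, write the negated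
satisfaction bit (mod `Pw`) to cell `r32 + q`, advance. [folklore] -/
def clauseBody : SProg := seqs [
  block [(.band, r 23, pt 20, pt 20), (.add, r 20, r 20, im 1), (.band, r 25, im 0, im 0)],
  whilenz (r 23) litBody,
  block [(.eq, r 26, r 25, im 0), (.mod, r 26, r 26, r 13), (.add, r 27, r 32, r 21),
    (.band, pt 27, r 26, r 26), (.add, r 21, r 21, im 1), (.sub, r 22, r 22, im 1)]]

/-- **The row pass**: one sequential pass over the encoded clauses, writing the row of the
assignment word `r30` (side `r31`) to the cells from `r32` on. [folklore] -/
def rowPass : SProg := seqs [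
  block [(.add, r 20, r 0, im 2), (.band, r 21, im 0, im 0), (.band, r 22, r 3, r 3)],
  whilenz (r 22) clauseBody]

/-- Rows of the first side, one row `p = r40`: assignment word `p`, side `1`, cells from
`Bv + 3 + p d`. [folklore] -/
def rowA : SProg := seqs [
  block [(.band, r 30, r 40, r 40), (.band, r 31, im 1, im 1), (.mul, r 32, r 40, r 6),
    (.add, r 32, r 32, im 3), (.add, r 32, r 32, r 10)],
  rowPass,
  block [(.add, r 40, r 40, im 1), (.sub, r 41, r 41, im 1)]]

/-- The `N` rows of the first side. [folklore] -/
def rowsA : SProg := seqs [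
  block [(.band, r 40, im 0, im 0), (.band, r 41, r 5, r 5)],
  whilenz (r 41) rowA]

/-- Rows of the second side, one row `q = r40`: assignment word `q N = q 2^h`, side `0`, cells from
`Bv + 3 + N d + q d`. [folklore] -/
def rowB : SProg := seqs [
  block [(.mul, r 30, r 40, r 5), (.band, r 31, im 0, im 0), (.mul, r 32, r 40, r 6),
    (.add, r 32, r 32, r 7), (.add, r 32, r 32, im 3), (.add, r 32, r 32, r 10)],
  rowPass,
  block [(.add, r 40, r 40, im 1), (.sub, r 41, r 41, im 1)]]

/-- The `N` rows of the second side. [folklore] -/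
def rowsB : SProg := seqs [
  block [(.band, r 40, im 0, im 0), (.band, r 41, r 5, r 5)],
  whilenz (r 41) rowB]

/-! ### The build, the reduction program -/

/-- **The build**: relocate the input, compute the constants, the header and the `2N` rows of the
emulated OV input, clear the scratch. (`c`: dimension constant; `kM`, `cM`: word-size constant and
largest constant of the OV program.) [folklore] -/
def pre (c kM cM : ℕ) : SProg := seqs [
  relocate, setup1 c, CliqueRed.sizeLoop, setup3 kM cM, header, rowsA, rowsB, CliqueRed.clearRegs]

/-- **The reduction program**: sparse `k`-SAT by one emulated run of the OV program `M` on the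
split-and-list instance (Williams 2005, §5.1). [folklore] -/
def reduction (M : Program) (c kM : ℕ) : Program :=
  withSubrun (pre c kM M.maxConst) lay M CliqueRed.post

/-- The row pass is query-free. [folklore] -/
theorem rowPass_queryFree : rowPass.QueryFree := by
  simp [rowPass, clauseBody, litBody, seqs, QueryFree, block_queryFree]

/-- The build is query-free. [folklore] -/
theorem pre_queryFree (c kM cM : ℕ) : (pre c kM cM).QueryFree := by
  refine seqs_queryFree ?_
  simp only [List.mem_cons, List.not_mem_nil, or_false]
  rintro s (rfl | rfl | rfl | rfl | rfl | rfl | rfl | rfl)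
  · exact relocate_queryFree
  · exact block_queryFree _
  · exact block_queryFree _
  · refine seqs_queryFree ?_
    simp only [List.mem_cons, List.not_mem_nil, or_false]
    rintro s (rfl | rfl | rfl | rfl | rfl)
    · exact block_queryFree _
    · exact ⟨trivial, block_queryFree _⟩
    · exact block_queryFree _
    · exact ⟨trivial, block_queryFree _⟩
    · exact block_queryFree _
  · exact block_queryFree _
  · simp [rowsA, rowA, seqs, QueryFree, block_queryFree, rowPass_queryFree]
  · simp [rowsB, rowB, seqs, QueryFree, block_queryFree, rowPass_queryFree]
  · exact block_queryFree _

/-- The reduction program is deterministic. [folklore] -/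
theorem reduction_isDeterministic (M : Program) (c kM : ℕ) : (reduction M c kM).IsDeterministic :=
  withSubrun_isDeterministic _ _ _ _

/-- The reduction program is oracle-free. [folklore] -/
theorem reduction_isOracleFree (M : Program) (c kM : ℕ) : (reduction M c kM).IsOracleFree :=
  withSubrun_isOracleFree (pre_queryFree _ _ _) CliqueRed.post_queryFree _ _

end OVRed

end Literature.Computability.FineGrained

namespace Literature.Computability.FineGrained

open Cryptography Cryptography.WordRAM Complexity Cryptography.WordRAM.SProg

namespace OVRed

open SplitList (half satW half_le le_two_mul_half)

/-! ### Ghost parameters of a run -/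

/-- The data of a run of the reduction: the formula, the dimension constant `c`, and the word-size
constant `kM` and largest constant `cM` of the OV program. [folklore] -/
structure Params where
  /-- The input formula. -/
  φ : CNF ℕ
  /-- The dimension constant (`d = c h`). -/
  c : ℕ
  /-- The word-size constant of the OV program. -/
  kM : ℕ
  /-- The largest constant of the OV program. -/
  cM : ℕ

namespace Params

variable (g : Params)

/-- The input words. [folklore] -/
def x : List ℕ := encodeCNFWords g.φ
/-- The input length `Lx`. [folklore] -/
def Lx : ℕ := g.x.length
/-- The base `X` of the relocated input: `x[j]` sits in cell `X + j`. [folklore] -/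
def X : ℕ := g.Lx + 101
/-- The number of variables. [folklore] -/
def n : ℕ := g.φ.numVars
/-- The number of clauses. [folklore] -/
def m : ℕ := g.φ.length
/-- The split point `h = ⌈n/2⌉`. [folklore] -/
def h : ℕ := half g.n
/-- The number of vectors per side, `N = 2^h`. [folklore] -/
def N : ℕ := 2 ^ g.h
/-- The dimension `d = c h`. [folklore] -/
def d : ℕ := g.c * g.h
/-- `N d`, the number of words of one side. [folklore] -/
def Nd : ℕ := g.N * g.d
/-- Base of the emulated cells (right above the relocated input). [folklore] -/
def Bv : ℕ := g.X + g.Lx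
/-- The emulated word size `ws = kM · size (2 N d + 2)`. [folklore] -/
def ws : ℕ := g.kM * Nat.size (2 * g.Nd + 2)
/-- The emulated modulus `Pw = 2^ws`. [folklore] -/
def Pw : ℕ := 2 ^ g.ws
/-- The value bound `V = max (Pw - 1) (max cM (2 N d + 2))` of the emulation. [folklore] -/
def V : ℕ := max (g.Pw - 1) (max g.cM (2 * g.Nd + 2))
/-- Base of the stamps. [folklore] -/
def Sv : ℕ := g.Bv + g.V + 1
/-- The emulator environment: cells at `Bv`, stamps at `Sv`, generation `0`, word size `ws`,
region size `V + 1`. [folklore] -/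
def env : Env := ⟨g.Bv, g.Sv, 0, g.ws, g.V + 1⟩

/-- The chain of bases. [folklore] -/
theorem bases : 100 < g.X ∧ g.X + g.Lx = g.Bv ∧ g.Bv + g.V + 1 = g.Sv := by
  refine ⟨by unfold X; omega, rfl, rfl⟩

/-- `2 ≤ Lx`: the encoding starts with `numVars, numClauses`. [folklore] -/
theorem two_le_Lx : 2 ≤ g.Lx := by
  unfold Lx x; rw [length_encodeCNFWords_eq]; omega

/-- `1 ≤ N`. [folklore] -/
theorem one_le_N : 1 ≤ g.N := Nat.one_le_two_pow

/-- `2 N d + 2 ≤ V`, `cM ≤ V`, `Pw - 1 ≤ V`. [folklore] -/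
theorem le_V : 2 * g.Nd + 2 ≤ g.V ∧ g.cM ≤ g.V ∧ g.Pw - 1 ≤ g.V :=
  ⟨le_max_of_le_right (le_max_right _ _), le_max_of_le_right (le_max_left _ _), le_max_left _ _⟩

/-- The vector number and dimension are those of the split instance. [folklore] -/
theorem N_eq : g.N = (splitOV g.φ g.c).n := rfl

/-- The dimension is that of the split instance. [folklore] -/
theorem d_eq : g.d = (splitOV g.φ g.c).d := rfl

/-- **Requirements of a run at word size `W`**: the stamps fit (`Sv + V + 1 ≤ 2 ^ W`, whence every
address and value fits), the emulated word size is below `W`, the second-side assignment words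
`q N < N²` fit, the input width is at most `W` (so the input is stored exactly), and all `m`
clauses fit into the dimension `d`. [folklore] -/
structure Fits (W : ℕ) : Prop where
  top : g.Sv + g.V + 1 ≤ 2 ^ W
  ws_lt : g.ws < W
  sq : g.N * g.N < 2 ^ W
  width_lt : inputWidth g.x < W
  md : g.m ≤ g.d

/-- Under `Fits`, the input width is at most `W`. [folklore] -/
theorem Fits.width {g : Params} {W : ℕ} (hF : g.Fits W) : inputWidth g.x ≤ W := hF.width_lt.le

/-- Under `Fits`, the input words fit, with room for one increment. [folklore] -/
theorem Fits.input_succ {g : Params} {W : ℕ} (hF : g.Fits W) : ∀ v ∈ g.x, v + 1 < 2 ^ W :=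
  fun v hv => lt_of_le_of_lt (lt_two_pow_inputWidth_of_mem g.x v hv)
    (Nat.pow_lt_pow_right (by norm_num) hF.width_lt)

/-- Under `Fits`, the input words fit. [folklore] -/
theorem Fits.input {g : Params} {W : ℕ} (hF : g.Fits W) : ∀ v ∈ g.x, v < 2 ^ W := fun v hv =>
  Nat.lt_of_succ_lt (hF.input_succ v hv)

/-- The emulated input: the `OV` encoding of the split instance. [folklore] -/
noncomputable def y : List ℕ := OV.encode (splitOV g.φ g.c)

/-- Emulated cell `j` of the initial memory of the OV program on `y` (word size `ws`): `|y|` in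
cell `0`, `y[j - 1]` in cell `j`, reduced modulo `Pw`, and `0` past the input. [folklore] -/
noncomputable def ycell (j : ℕ) : ℕ :=
  if j = 0 then (2 * g.Nd + 2) % g.Pw else (g.y.getD (j - 1) 0) % g.Pw

/-! ### The intended data memory, stage by stage

All stages agree below `Bv` with the relocated input `relocated x`; the stage parameter `t` says
how many emulated cells have been written (header, then the rows, in order). -/

/-- Data after `t` emulated cells. [folklore] -/
noncomputable def fillData (t a : ℕ) : ℕ :=
  if a < g.Bv then relocated g.x a else if a - g.Bv < t then g.ycell (a - g.Bv) else 0

/-- The final data: the relocated input and the emulated input `y`. [folklore] -/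
noncomputable def finData (a : ℕ) : ℕ :=
  if a < g.Bv then relocated g.x a else g.ycell (a - g.Bv)

/-- **The final memory of the build**: registers `10–13` hold `Bv, Sv, 0, Pw`, every other
register is `0`, and the data is `finData`. [folklore] -/
noncomputable def finMem (a : ℕ) : ℕ :=
  if a < 100 then (if a = 10 then g.Bv else if a = 11 then g.Sv else if a = 13 then g.Pw else 0)
  else g.finData a

/-! ### Register conventions -/

/-- The registers after the setup: `X, n, m, h, N, d, N d, Bv`. [folklore] -/
structure Regs (mem : ℕ → ℕ) : Prop where
  r0 : mem 0 = g.X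
  r2 : mem 2 = g.n
  r3 : mem 3 = g.m
  r4 : mem 4 = g.h
  r5 : mem 5 = g.N
  r6 : mem 6 = g.d
  r7 : mem 7 = g.Nd
  r10 : mem 10 = g.Bv

/-- The environment registers: `Sv, Gv = 0, Pw`. [folklore] -/
structure ERegs (mem : ℕ → ℕ) : Prop where
  r11 : mem 11 = g.Sv
  r12 : mem 12 = 0
  r13 : mem 13 = g.Pw

variable {g}

/-- `Regs` survives changes above register `10`. [folklore] -/
theorem Regs.of_frame {mem mem' : ℕ → ℕ} (hR : g.Regs mem) (hf : ∀ a, a ≤ 10 → mem' a = mem a) :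
    g.Regs mem' :=
  ⟨(hf 0 (by omega)).trans hR.r0, (hf 2 (by omega)).trans hR.r2, (hf 3 (by omega)).trans hR.r3,
    (hf 4 (by omega)).trans hR.r4, (hf 5 (by omega)).trans hR.r5, (hf 6 (by omega)).trans hR.r6,
    (hf 7 (by omega)).trans hR.r7, (hf 10 (by omega)).trans hR.r10⟩

/-- `ERegs` survives changes outside `11–13`. [folklore] -/
theorem ERegs.of_frame {mem mem' : ℕ → ℕ} (hE : g.ERegs mem)
    (hf : ∀ a, 11 ≤ a → a ≤ 13 → mem' a = mem a) : g.ERegs mem' :=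
  ⟨(hf 11 (by omega) (by omega)).trans hE.r11, (hf 12 (by omega) (by omega)).trans hE.r12,
    (hf 13 (by omega) (by omega)).trans hE.r13⟩

variable (g)

/-! ### Reading the relocated input -/

/-- Cell `0` after relocation holds `X`. [folklore] -/
@[simp] theorem relocated_zero' : relocated g.x 0 = g.X := by
  rw [relocated_zero]; rfl

/-- Cell `1` after relocation holds `X - 1`. [folklore] -/
@[simp] theorem relocated_one' : relocated g.x 1 = g.X - 1 := by
  rw [relocated_one]; unfold X Lx; omega

/-- The relocated input: `x[j]` sits in cell `X + j` (and `0` past the input). [folklore] -/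
theorem relocated_X_add (j : ℕ) : relocated g.x (g.X + j) = g.x.getD j 0 := by
  by_cases hj : j < g.Lx
  · have := relocated_base_add g.x (i := j + 1) (by omega) (by unfold Lx at hj; omega)
    rw [show g.x.length + 100 + (j + 1) = g.X + j by unfold X Lx; omega] at this
    rw [this]; rfl
  · rw [relocated_of_lt g.x (by unfold X Lx at *; omega),
      List.getD_eq_default _ _ (by unfold Lx at hj; omega)]

/-- Cell `X` itself holds `x[0]` (the case `j = 0` of `relocated_X_add`). [folklore] -/
theorem relocated_X : relocated g.x g.X = g.x.getD 0 0 := by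
  simpa using g.relocated_X_add 0

/-- Everything above the relocated input is `0`. [folklore] -/
theorem relocated_of_Bv_le {a : ℕ} (ha : g.Bv ≤ a) : relocated g.x a = 0 :=
  relocated_of_lt g.x (by unfold Bv X Lx at ha; omega)

/-- Word `1` of the input is `m`. [folklore] -/
theorem x_getD_one : g.x.getD 1 0 = g.m := by
  have := encodeCNFWords_getElem?_one g.φ
  unfold x m; rw [List.getD_eq_getElem?_getD, this]; rfl

/-- Word `0` of the input is `n = numVars`. [folklore] -/
theorem x_getD_zero : g.x.getD 0 0 = g.n := by
  have := encodeCNFWords_getElem?_zero g.φ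
  unfold x n; rw [List.getD_eq_getElem?_getD, this]; rfl

/-- `m + 2 ≤ Lx`. [folklore] -/
theorem m_add_two_le_Lx : g.m + 2 ≤ g.Lx := by
  unfold Lx x m; rw [length_encodeCNFWords_eq, CNF.numClauses]; omega

/-- `n` is an input word, hence `n + 1 < 2 ^ W`. [folklore] -/
theorem n_succ_lt {W : ℕ} (hF : g.Fits W) : g.n + 1 < 2 ^ W := by
  have h := hF.input_succ (g.x.getD 0 0) (by
    rw [List.getD_eq_getElem _ _ (by have := g.two_le_Lx; unfold Lx at this; omega)]
    exact List.getElem_mem _)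
  rwa [x_getD_zero] at h

/-- The standard linear facts about the ghost parameters under `Fits`. [folklore] -/
theorem facts {W : ℕ} (hF : g.Fits W) :
    100 < g.X ∧ g.X = g.Lx + 101 ∧ g.X + g.Lx = g.Bv ∧ g.Bv + g.V + 1 = g.Sv ∧
    g.Sv + g.V + 1 ≤ 2 ^ W ∧ 2 * g.Nd + 2 ≤ g.V ∧ g.Pw ≤ g.V + 1 ∧ g.cM ≤ g.V ∧
    g.m + 2 ≤ g.Lx ∧ 1 ≤ g.N ∧ 1 ≤ g.Pw ∧ g.N * g.N < 2 ^ W ∧ g.N ≤ g.N * g.N ∧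
    g.Nd = g.N * g.d ∧ g.d ≤ g.Nd ∧ g.m ≤ g.d ∧ g.h ≤ g.n ∧ g.n + 1 < 2 ^ W ∧ g.N = 2 ^ g.h := by
  obtain ⟨h1, h2, h3⟩ := g.bases
  have h4 := g.le_V
  have hN := g.one_le_N
  refine ⟨h1, rfl, h2, h3, hF.top, h4.1, by omega, h4.2.1, g.m_add_two_le_Lx, hN,
    Nat.one_le_two_pow, hF.sq, Nat.le_mul_self _, rfl, Nat.le_mul_of_pos_left _ hN, hF.md,
    half_le _, g.n_succ_lt hF, rfl⟩

/-! ### The cells of the emulated input -/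

/-- Emulated cell `0`: the length `2 N d + 2`. [folklore] -/
theorem ycell_zero : g.ycell 0 = (2 * g.Nd + 2) % g.Pw := rfl

/-- Emulated cell `1`: `N`. [folklore] -/
theorem ycell_one : g.ycell 1 = g.N % g.Pw := by
  unfold ycell y; rw [if_neg one_ne_zero, List.getD_eq_getElem?_getD, OV_encode_getElem?_zero]
  rfl

/-- Emulated cell `2`: `d`. [folklore] -/
theorem ycell_two : g.ycell 2 = g.d % g.Pw := by
  unfold ycell y; rw [if_neg (by norm_num), List.getD_eq_getElem?_getD, OV_encode_getElem?_one]
  rfl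

/-- Emulated cell `3 + (p d + q)`, `p < N`, `q < d`: coordinate `q` of row `p` of the first side.
[folklore] -/
theorem ycell_A {p q : ℕ} (hp : p < g.N) (hq : q < g.d) :
    g.ycell (3 + (p * g.d + q)) = (vecBit g.φ g.h p true q).toNat % g.Pw := by
  have := OV_encode_getElem?_A (splitOV g.φ g.c) ⟨p, hp⟩ ⟨q, hq⟩
  unfold ycell y
  rw [if_neg (by omega), List.getD_eq_getElem?_getD, show 3 + (p * g.d + q) - 1 = 2 + (p * g.d + q)
    by omega]
  rw [g.d_eq, this]
  rfl

/-- Emulated cell `3 + (N d + (p d + q))`, `p < N`, `q < d`: coordinate `q` of row `p` of the second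
side. [folklore] -/
theorem ycell_B {p q : ℕ} (hp : p < g.N) (hq : q < g.d) :
    g.ycell (3 + (g.Nd + (p * g.d + q))) = (vecBit g.φ g.h (p * g.N) false q).toNat % g.Pw := by
  have := OV_encode_getElem?_B (splitOV g.φ g.c) ⟨p, hp⟩ ⟨q, hq⟩
  unfold ycell y
  rw [if_neg (by omega), List.getD_eq_getElem?_getD,
    show 3 + (g.Nd + (p * g.d + q)) - 1 = 2 + (g.Nd + (p * g.d + q)) by omega]
  unfold Nd
  rw [g.d_eq, g.N_eq, this]
  rfl

/-- Past the emulated input every cell is `0`. [folklore] -/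
theorem ycell_of_le {j : ℕ} (hj : 2 * g.Nd + 3 ≤ j) : g.ycell j = 0 := by
  have hlen : g.y.length = 2 * g.Nd + 2 := by
    unfold y Nd; rw [length_encode_splitOV, ← g.N_eq, ← g.d_eq]
  unfold ycell
  rw [if_neg (by omega), List.getD_eq_default _ _ (by omega), Nat.zero_mod]

/-- The padding coordinates `m ≤ q < d` of a first-side row are `0`. [folklore] -/
theorem ycell_A_pad {p q : ℕ} (hp : p < g.N) (hq : q < g.d) (hmq : g.m ≤ q) :
    g.ycell (3 + (p * g.d + q)) = 0 := by
  rw [g.ycell_A hp hq, vecBit_of_le hmq]; simp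

/-- The padding coordinates `m ≤ q < d` of a second-side row are `0`. [folklore] -/
theorem ycell_B_pad {p q : ℕ} (hp : p < g.N) (hq : q < g.d) (hmq : g.m ≤ q) :
    g.ycell (3 + (g.Nd + (p * g.d + q))) = 0 := by
  rw [g.ycell_B hp hq, vecBit_of_le hmq]; simp

/-- Every emulated cell is below `Pw`. [folklore] -/
theorem ycell_lt_Pw (j : ℕ) : g.ycell j < g.Pw := by
  unfold ycell; split_ifs <;> exact Nat.mod_lt _ (Nat.two_pow_pos _)

/-! ### Stepping the data -/

/-- Below `Bv` every stage of the data is the relocated input. [folklore] -/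
theorem fillData_of_lt_Bv (t : ℕ) {a : ℕ} (ha : a < g.Bv) : g.fillData t a = relocated g.x a := by
  unfold fillData; rw [if_pos ha]

/-- Stage `0` is the relocated memory. [folklore] -/
theorem fillData_zero (a : ℕ) : g.fillData 0 a = relocated g.x a := by
  unfold fillData
  by_cases ha : a < g.Bv
  · rw [if_pos ha]
  · rw [if_neg ha, g.relocated_of_Bv_le (not_lt.1 ha)]; simp

/-- **One emulated cell written**: writing `ycell t` at `Bv + t` turns stage `t` into stage
`t + 1`. [folklore] -/
theorem fillData_succ {t : ℕ} {mem : ℕ → ℕ} (hm : ∀ a, 100 ≤ a → mem a = g.fillData t a) (a : ℕ)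
    (ha : 100 ≤ a) : Function.update mem (g.Bv + t) (g.ycell t) a = g.fillData (t + 1) a := by
  obtain ⟨hX, hBv, -⟩ := g.bases
  by_cases h1 : a = g.Bv + t
  · subst h1; rw [Function.update_self]; unfold fillData
    rw [if_neg (by omega), if_pos (by omega), Nat.add_sub_cancel_left]
  rw [Function.update_of_ne h1, hm a ha]
  unfold fillData
  by_cases h2 : a < g.Bv
  · rw [if_pos h2, if_pos h2]
  rw [if_neg h2, if_neg h2]
  have : (a - g.Bv < t) ↔ (a - g.Bv < t + 1) := by omega
  simp only [this]

/-- Stages agree when the emulated cells in between are `0`. [folklore] -/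
theorem fillData_eq_of_zero {t t' : ℕ} (htt : t ≤ t') (hz : ∀ j, t ≤ j → j < t' → g.ycell j = 0)
    (a : ℕ) : g.fillData t a = g.fillData t' a := by
  unfold fillData
  by_cases h2 : a < g.Bv
  · rw [if_pos h2, if_pos h2]
  rw [if_neg h2, if_neg h2]
  by_cases h3 : a - g.Bv < t
  · rw [if_pos h3, if_pos (by omega)]
  rw [if_neg h3]
  by_cases h4 : a - g.Bv < t'
  · rw [if_pos h4, hz _ (by omega) h4]
  rw [if_neg h4]

/-- The last stage is the final data. [folklore] -/
theorem fillData_top (a : ℕ) : g.fillData (2 * g.Nd + 3) a = g.finData a := by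
  unfold fillData finData
  by_cases h2 : a < g.Bv
  · rw [if_pos h2, if_pos h2]
  rw [if_neg h2, if_neg h2]
  by_cases h3 : a - g.Bv < 2 * g.Nd + 3
  · rw [if_pos h3]
  · rw [if_neg h3, g.ycell_of_le (by omega)]

/-- A first-side row is complete once its `m` clause cells are written: the padding cells are `0`.
[folklore] -/
theorem fillData_rowA_done {W : ℕ} (hF : g.Fits W) {p : ℕ} (hp : p < g.N) (a : ℕ) :
    g.fillData (3 + p * g.d + g.m) a = g.fillData (3 + (p + 1) * g.d) a := by
  have hmd := hF.md
  refine g.fillData_eq_of_zero (by rw [Nat.succ_mul]; omega) (fun j hj hj' => ?_) a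
  rw [Nat.succ_mul] at hj'
  have := g.ycell_A_pad hp (q := j - (3 + p * g.d)) (by omega) (by omega)
  rwa [show 3 + (p * g.d + (j - (3 + p * g.d))) = j by omega] at this

/-- A second-side row is complete once its `m` clause cells are written. [folklore] -/
theorem fillData_rowB_done {W : ℕ} (hF : g.Fits W) {p : ℕ} (hp : p < g.N) (a : ℕ) :
    g.fillData (3 + g.Nd + p * g.d + g.m) a = g.fillData (3 + g.Nd + (p + 1) * g.d) a := by
  have hmd := hF.md
  refine g.fillData_eq_of_zero (by rw [Nat.succ_mul]; omega) (fun j hj hj' => ?_) a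
  rw [Nat.succ_mul] at hj'
  have := g.ycell_B_pad hp (q := j - (3 + g.Nd + p * g.d)) (by omega) (by omega)
  rwa [show 3 + (g.Nd + (p * g.d + (j - (3 + g.Nd + p * g.d)))) = j by omega] at this

end Params

end OVRed

end Literature.Computability.FineGrained

namespace Literature.Computability.FineGrained

open Cryptography Cryptography.WordRAM Complexity Cryptography.WordRAM.SProg

namespace OVRed

open CliqueRed (r pt im lay achieves_block_of_eq)
open SplitList (half satW half_le le_two_mul_half)

namespace Params

variable (g : Params) {W : ℕ} {O : List ℕ → List ℕ}

/-! ### The setup phase -/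

/-- **Setup, part 1.** From the relocated memory, `setup1` computes the registers `Regs`, leaves
`r1 = X - 1`, `r21 = 2 N d + 2`, `r22 = 0`, and does not touch the data. [folklore] -/
theorem setup1_spec (hF : g.Fits W) :
    Achieves W O (setup1 g.c) (relocated g.x)
      (fun mem => g.Regs mem ∧ mem 1 = g.X - 1 ∧ mem 21 = 2 * g.Nd + 2 ∧ mem 22 = 0 ∧
        ∀ a, 100 ≤ a → mem a = relocated g.x a) 14 := by
  obtain ⟨hX, hXLx, hBv, hSv, htop, hNdV, hPwV, hcMV, hmLx, hN1, hPw1, hNN, hNNN, hNd, hdNd, hmd,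
    hhn, hnW, hN⟩ := g.facts hF
  have hh : (g.n + 1) >>> 1 = g.h := by rw [Nat.shiftRight_eq_div_pow]; rfl
  have hd : g.h * g.c = g.d := Nat.mul_comm _ _
  have hNd' : g.N * g.d = g.Nd := rfl
  have hN' : 1 * 2 ^ g.h = g.N := by rw [Nat.one_mul]; exact hN.symm
  have hread0 : relocated g.x g.X = g.n := by rw [relocated_X, x_getD_zero]
  have hread1 : relocated g.x (g.X + 1) = g.m := by rw [relocated_X_add, x_getD_one]
  have hdV : g.d ≤ g.V := by omega
  refine achieves_block_of_eq (fun m' hm' => ?_) le_rfl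
  simp (disch := first | omega | decide) only [execOps_cons, execOps_nil, execOp,
    Operand.write, Operand.read, merge_apply_of_lt, merge_apply_of_le, update_merge_of_lt,
    Function.update_self, Function.update_of_ne, BinOp.eval_add_of_lt, BinOp.eval_sub_of_le,
    BinOp.eval_mul_of_lt, BinOp.eval_shl_of_lt, BinOp.eval_shr, BinOp.eval_band, Nat.and_self,
    relocated_zero', relocated_one', hread0, hread1, hh, hN', hd, hNd'] at hm'
  subst hm'
  refine ⟨⟨?_, ?_, ?_, ?_, ?_, ?_, ?_, ?_⟩, ?_, ?_, ?_, fun a ha => ?_⟩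
  all_goals (try simp (disch := first | omega | decide) only [merge_apply_of_lt,
    merge_apply_of_le, Function.update_self, Function.update_of_ne])
  all_goals (try simp only [relocated_zero', relocated_one'])
  all_goals omega

/-- **Setup, part 3.** From the registers of `setup1` and `r22 = size (2 N d + 2)`, `setup3` sets
the environment registers `Sv, Gv = 0, Pw` (`ERegs`), keeping `Regs` and the data. [folklore] -/
theorem setup3_spec (hF : g.Fits W) {mem : ℕ → ℕ} (hR : g.Regs mem)
    (h22 : mem 22 = Nat.size (2 * g.Nd + 2)) (hD : ∀ a, 100 ≤ a → mem a = relocated g.x a) :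
    Achieves W O (setup3 g.kM g.cM) mem
      (fun mem' => g.Regs mem' ∧ g.ERegs mem' ∧ ∀ a, 100 ≤ a → mem' a = relocated g.x a) 16 := by
  obtain ⟨hX, hXLx, hBv, hSv, htop, hNdV, hPwV, hcMV, hmLx, hN1, hPw1, hNN, hNNN, hNd, hdNd, hmd,
    hhn, hnW, hN⟩ := g.facts hF
  have hwsW : g.ws < W := hF.ws_lt
  have hW : W < 2 ^ W := Nat.lt_two_pow_self
  have hws : Nat.size (2 * g.Nd + 2) * g.kM = g.ws := Nat.mul_comm _ _
  have hPw : 2 ^ g.ws = g.Pw := rfl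
  have hPwW : g.Pw < 2 ^ W := Nat.pow_lt_pow_right (by norm_num) hwsW
  obtain ⟨r0, r2, r3, r4, r5, r6, r7, r10⟩ := hR
  unfold setup3
  -- block 1
  refine Achieves.seqs_cons (R := fun m₁ => m₁ 13 = g.Pw ∧ m₁ 23 = g.Pw - 1 ∧
      m₁ 24 = (if g.Pw - 1 < g.cM then 1 else 0) ∧ ∀ a, a ≠ 13 → a ≠ 22 → a ≠ 23 → a ≠ 24 →
        m₁ a = mem a) (T₁ := 4) (T₂ := 12) ?_ ?_
  · refine achieves_block_of_eq (fun m' hm' => ?_) le_rfl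
    simp (disch := first | omega | decide) only [execOps_cons, execOps_nil, execOp, Operand.write,
      Operand.read, merge_apply_of_lt, update_merge_of_lt, Function.update_self,
      BinOp.eval_sub_of_le, BinOp.eval_mul_of_lt, BinOp.eval_shl_of_lt, BinOp.eval_lt,
      Nat.one_mul, h22, hws, hPw] at hm'
    subst hm'
    refine ⟨?_, ?_, ?_, fun a h1 h2 h3 h4 => ?_⟩
    · (try simp (disch := first | omega | decide) only [merge_apply_of_lt, Function.update_self,
      Function.update_of_ne])
    · (try simp (disch := first | omega | decide) only [merge_apply_of_lt, Function.update_self,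
      Function.update_of_ne])
    · (try simp (disch := first | omega | decide) only [merge_apply_of_lt, Function.update_self])
    · by_cases ha : a < 100
      · rw [merge_apply_of_lt ha]; simp [Function.update_of_ne, h1, h2, h3, h4]
      · rw [merge_apply_of_le (by omega)]
  rintro m₁ ⟨q13, q23, q24, qf⟩
  -- ifz 1
  refine Achieves.seqs_cons (R := fun m₂ => m₂ 23 = max (g.Pw - 1) g.cM ∧
      ∀ a, a ≠ 22 → a ≠ 23 → a ≠ 24 → m₂ a = m₁ a) (T₁ := 3) (T₂ := 9) ?_ ?_
  · refine Achieves.ifz (fun h0 => Achieves.skip ⟨?_, fun a _ _ _ => rfl⟩) (fun h1 => ?_)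
    · simp only [Operand.read, q24] at h0
      have hc : ¬ g.Pw - 1 < g.cM := fun hc => by simp [hc] at h0
      rw [q23, max_eq_left (not_lt.1 hc)]
    · simp only [Operand.read, q24] at h1
      have hlt : g.Pw - 1 < g.cM := by by_contra hc; simp [hc] at h1
      refine achieves_block_of_eq (fun m' hm' => ?_) le_rfl
      simp (disch := first | omega | decide) only [execOps_cons, execOps_nil, execOp,
        Operand.write, Operand.read, update_merge_of_lt, BinOp.eval_band, Nat.and_self] at hm'
      subst hm'
      refine ⟨?_, fun a _ h23 _ => ?_⟩
      · (try simp (disch := first | omega | decide) only [merge_apply_of_lt,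
        Function.update_self]); rw [max_eq_right hlt.le]
      · by_cases ha : a < 100
        · rw [merge_apply_of_lt ha, Function.update_of_ne h23]
        · rw [merge_apply_of_le (by omega)]
  rintro m₂ ⟨p23, pf⟩
  have p7 : m₂ 7 = g.Nd := by
    rw [pf 7 (by omega) (by omega) (by omega), qf 7 (by omega) (by omega) (by omega) (by omega), r7]
  have hmaxV : max (g.Pw - 1) g.cM ≤ g.V := max_le (by omega) hcMV
  -- block 2
  refine Achieves.seqs_cons (R := fun m₃ => m₃ 23 = max (g.Pw - 1) g.cM ∧
      m₃ 25 = 2 * g.Nd + 2 ∧ m₃ 24 = (if max (g.Pw - 1) g.cM < 2 * g.Nd + 2 then 1 else 0) ∧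
      ∀ a, a ≠ 22 → a ≠ 23 → a ≠ 24 → a ≠ 25 → m₃ a = m₁ a) (T₁ := 3) (T₂ := 6) ?_ ?_
  · refine achieves_block_of_eq (fun m' hm' => ?_) le_rfl
    have hNd2 : g.Nd * 2 = 2 * g.Nd := Nat.mul_comm _ _
    simp (disch := first | omega | decide) only [execOps_cons, execOps_nil, execOp, Operand.write,
      Operand.read, merge_apply_of_lt, update_merge_of_lt, Function.update_self,
      Function.update_of_ne, BinOp.eval_add_of_lt, BinOp.eval_mul_of_lt, BinOp.eval_lt, p23,
      p7, hNd2] at hm'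
    subst hm'
    refine ⟨?_, ?_, ?_, fun a h1 h2 h3 h4 => ?_⟩
    · (try simp (disch := first | omega | decide) only [merge_apply_of_lt,
      Function.update_of_ne]); exact p23
    · (try simp (disch := first | omega | decide) only [merge_apply_of_lt, Function.update_self,
      Function.update_of_ne])
    · (try simp (disch := first | omega | decide) only [merge_apply_of_lt, Function.update_self])
    · by_cases ha : a < 100
      · rw [merge_apply_of_lt ha]; simp [Function.update_of_ne, h3, h4, pf a h1 h2 h3]
      · rw [merge_apply_of_le (by omega), pf a h1 h2 h3]
  rintro m₃ ⟨s23, s25, s24, sf⟩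
  -- ifz 2
  refine Achieves.seqs_cons (R := fun m₄ => m₄ 23 = g.V ∧
      ∀ a, a ≠ 22 → a ≠ 23 → a ≠ 24 → a ≠ 25 → m₄ a = m₁ a) (T₁ := 3) (T₂ := 3) ?_ ?_
  · refine Achieves.ifz (fun h0 => Achieves.skip ⟨?_, sf⟩) (fun h1 => ?_)
    · simp only [Operand.read, s24] at h0
      have hc : ¬ max (g.Pw - 1) g.cM < 2 * g.Nd + 2 := fun hc => by simp [hc] at h0
      rw [s23]; show _ = max (g.Pw - 1) (max g.cM (2 * g.Nd + 2))
      rw [← max_assoc, max_eq_left (not_lt.1 hc)]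
    · simp only [Operand.read, s24] at h1
      have hlt : max (g.Pw - 1) g.cM < 2 * g.Nd + 2 := by by_contra hc; simp [hc] at h1
      refine achieves_block_of_eq (fun m' hm' => ?_) le_rfl
      simp (disch := first | omega | decide) only [execOps_cons, execOps_nil, execOp,
        Operand.write, Operand.read, merge_apply_of_lt, update_merge_of_lt, BinOp.eval_band,
        Nat.and_self, s25] at hm'
      subst hm'
      refine ⟨?_, fun a h22 h23 h24 h25 => ?_⟩
      · (try simp (disch := first | omega | decide) only [merge_apply_of_lt,
        Function.update_self]); show _ = max (g.Pw - 1) (max g.cM (2 * g.Nd + 2))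
        rw [← max_assoc, max_eq_right hlt.le]
      · by_cases ha : a < 100
        · rw [merge_apply_of_lt ha, Function.update_of_ne h23, sf a h22 h23 h24 h25]
        · rw [merge_apply_of_le (by omega), sf a h22 h23 h24 h25]
  rintro m₄ ⟨t23, tf⟩
  have back : ∀ a, a ≠ 13 → a ≠ 22 → a ≠ 23 → a ≠ 24 → a ≠ 25 → m₄ a = mem a :=
    fun a h1 h2 h3 h4 h5 => by rw [tf a h2 h3 h4 h5, qf a h1 h2 h3 h4]
  have t10 : m₄ 10 = g.Bv := by
    rw [back 10 (by omega) (by omega) (by omega) (by omega) (by omega), r10]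
  -- block 3
  refine Achieves.seqs_cons (T₁ := 3) (T₂ := 0) ?_ (fun _ h => Achieves.seqs_nil h)
  refine achieves_block_of_eq (fun m' hm' => ?_) le_rfl
  simp (disch := first | omega | decide) only [execOps_cons, execOps_nil, execOp, Operand.write,
    Operand.read, merge_apply_of_lt, update_merge_of_lt, Function.update_self,
    BinOp.eval_add_of_lt, BinOp.eval_band, Nat.and_self, t23, t10] at hm'
  subst hm'
  refine ⟨⟨?_, ?_, ?_, ?_, ?_, ?_, ?_, ?_⟩, ⟨?_, ?_, ?_⟩, fun a ha => ?_⟩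
  all_goals (try simp (disch := first | omega | decide) only [merge_apply_of_lt,
    merge_apply_of_le, Function.update_self, Function.update_of_ne])
  · rw [back 0 (by omega) (by omega) (by omega) (by omega) (by omega), r0]
  · rw [back 2 (by omega) (by omega) (by omega) (by omega) (by omega), r2]
  · rw [back 3 (by omega) (by omega) (by omega) (by omega) (by omega), r3]
  · rw [back 4 (by omega) (by omega) (by omega) (by omega) (by omega), r4]
  · rw [back 5 (by omega) (by omega) (by omega) (by omega) (by omega), r5]
  · rw [back 6 (by omega) (by omega) (by omega) (by omega) (by omega), r6]
  · rw [back 7 (by omega) (by omega) (by omega) (by omega) (by omega), r7]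
  · exact t10
  · omega
  · rw [tf 13 (by omega) (by omega) (by omega) (by omega), q13]
  · rw [back a (by omega) (by omega) (by omega) (by omega) (by omega), hD a ha]

/-! ### The header -/

/-- **The header written**: from the relocated data, the three header cells give stage `3`.
[folklore] -/
theorem fillData_header {mem : ℕ → ℕ} (hm : ∀ a, 100 ≤ a → mem a = relocated g.x a) (a : ℕ)
    (ha : 100 ≤ a) :
    Function.update (Function.update (Function.update mem g.Bv ((2 * g.Nd + 2) % g.Pw))
      (g.Bv + 1) (g.N % g.Pw)) (g.Bv + 2) (g.d % g.Pw) a = g.fillData 3 a := by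
  have h0 : ∀ a, 100 ≤ a → mem a = g.fillData 0 a := fun a ha => by rw [hm a ha, g.fillData_zero]
  have h1 := g.fillData_succ h0
  rw [Nat.add_zero, ycell_zero] at h1
  have h2 := g.fillData_succ h1
  rw [ycell_one] at h2
  have h3 := g.fillData_succ h2
  rw [ycell_two] at h3
  exact h3 a ha

/-- **The header.** [folklore] -/
theorem header_spec (hF : g.Fits W) {mem : ℕ → ℕ} (hR : g.Regs mem) (hE : g.ERegs mem)
    (hD : ∀ a, 100 ≤ a → mem a = relocated g.x a) :
    Achieves W O header mem
      (fun mem' => g.Regs mem' ∧ g.ERegs mem' ∧ ∀ a, 100 ≤ a → mem' a = g.fillData 3 a) 10 := by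
  obtain ⟨hX, hXLx, hBv, hSv, htop, hNdV, hPwV, hcMV, hmLx, hN1, hPw1, hNN, hNNN, hNd, hdNd, hmd,
    hhn, hnW, hN⟩ := g.facts hF
  obtain ⟨r0, r2, r3, r4, r5, r6, r7, r10⟩ := hR
  obtain ⟨r11, r12, r13⟩ := hE
  have hNd2 : g.Nd * 2 = 2 * g.Nd := Nat.mul_comm _ _
  refine achieves_block_of_eq (fun m' hm' => ?_) le_rfl
  simp (disch := first | omega | decide) only [execOps_cons, execOps_nil, execOp,
    Operand.write, Operand.read, merge_apply_of_lt, update_merge_of_lt, update_merge_of_le,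
    Function.update_self, Function.update_of_ne, BinOp.eval_add_of_lt, BinOp.eval_mul_of_lt,
    BinOp.eval_mod, BinOp.eval_band, Nat.and_self, r5, r6, r7, r10, r13, hNd2] at hm'
  subst hm'
  refine ⟨⟨?_, ?_, ?_, ?_, ?_, ?_, ?_, ?_⟩, ⟨?_, ?_, ?_⟩, fun a ha => ?data⟩
  case data =>
    (try simp (disch := first | omega | decide) only [merge_apply_of_le])
    exact g.fillData_header hD a ha
  all_goals (try simp (disch := first | omega | decide) only [merge_apply_of_lt,
    Function.update_of_ne])
  all_goals assumption

end Params

end OVRed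

end Literature.Computability.FineGrained

namespace Literature.Computability.FineGrained

open Cryptography Cryptography.WordRAM Complexity Cryptography.WordRAM.SProg

namespace OVRed

open CliqueRed (r pt im lay achieves_block_of_eq)
open SplitList (half satW half_le le_two_mul_half)

/-! ### The satisfaction bit, literal by literal -/

/-- The satisfaction bit of clause `C` (assignment word `P`, side `side`) after its first `l`
literals. [folklore] -/
def satUpTo (h P : ℕ) (side : Bool) (C : Clause ℕ) (l : ℕ) : Bool :=
  (C.take l).any (litSat h P side)

/-- No literal examined: not yet satisfied. [folklore] -/
theorem satUpTo_zero (h P : ℕ) (side : Bool) (C : Clause ℕ) : satUpTo h P side C 0 = false := by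
  simp [satUpTo]

/-- One more literal. [folklore] -/
theorem satUpTo_succ (h P : ℕ) (side : Bool) (C : Clause ℕ) {l : ℕ} (hl : l < C.length) :
    satUpTo h P side C (l + 1) = (satUpTo h P side C l || litSat h P side C[l]) := by
  rw [satUpTo, satUpTo, List.take_add_one, List.any_append, List.getElem?_eq_getElem hl]
  simp

/-- All literals: the satisfaction bit of the clause. [folklore] -/
theorem satUpTo_length (h P : ℕ) (side : Bool) (C : Clause ℕ) :
    satUpTo h P side C C.length = C.any (litSat h P side) := by
  simp [satUpTo]

/-- All literals of clause `q` of `φ`: the bit `satW`. [folklore] -/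
theorem satUpTo_getD_length (φ : CNF ℕ) (h P : ℕ) (side : Bool) (q : ℕ) :
    satUpTo h P side (φ.getD q []) (φ.getD q []).length = satW φ h side P q := by
  rw [satUpTo_length]; rfl

/-- **The arithmetic of the literal test**: the conjunction of the two comparison bits
"`[var < h] = side`" and "bit `var` of `P` = polarity", computed with `lt`/`eq`/`band`, is the
bit `litSat`. [folklore] -/
theorem litSat_toNat (h P : ℕ) (side : Bool) (l : Literal ℕ) :
    ((if (if l.1 < h then 1 else 0 : ℕ) = side.toNat then 1 else 0 : ℕ) &&&
      (if (P.testBit l.1).toNat = l.2.toNat then 1 else 0 : ℕ)) = (litSat h P side l).toNat := by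
  unfold litSat
  by_cases hv : l.1 < h <;> cases side <;> cases P.testBit l.1 <;> cases l.2 <;> simp [hv]

/-- **The arithmetic of one step of the accumulation**: OR-ing the bit `c` into the bit `s` as
`[[s = 0] ∧ [c = 0] < 1]`. [folklore] -/
theorem sat_step (s c : Bool) :
    (if ((if s.toNat = 0 then 1 else 0 : ℕ) &&& (if c.toNat = 0 then 1 else 0 : ℕ)) < 1 then 1
      else 0 : ℕ) = (s || c).toNat := by
  cases s <;> cases c <;> simp

/-- Negating a bit as `[b = 0]`. [folklore] -/
theorem ite_toNat_eq_zero (b : Bool) : (if b.toNat = 0 then 1 else 0 : ℕ) = (!b).toNat := by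
  cases b <;> simp

namespace Params

variable (g : Params) {W : ℕ} {O : List ℕ → List ℕ}

/-! ### Facts about the encoding -/

/-- The length word of clause `q` in the input. [folklore] -/
theorem x_getD_clauseStart {q : ℕ} (hq : q < g.m) :
    g.x.getD (clauseStart g.φ q) 0 = (g.φ[q]'hq).length := by
  have := encodeCNFWords_getElem?_clauseStart g.φ hq
  unfold x; rw [List.getD_eq_getElem?_getD, this]; rfl

/-- The literal words of clause `q` in the input. [folklore] -/
theorem x_getD_lit {q : ℕ} (hq : q < g.m) {l : ℕ} (hl : l < (g.φ[q]'hq).length) :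
    g.x.getD (clauseStart g.φ q + 1 + l) 0 = litCode ((g.φ[q]'hq)[l]'hl) := by
  have := encodeCNFWords_getElem?_clauseStart_succ g.φ hq hl
  unfold x; rw [List.getD_eq_getElem?_getD, this]; rfl

/-- Clause blocks lie inside the input. [folklore] -/
theorem clauseStart_le {q : ℕ} (hq : q < g.m) :
    clauseStart g.φ q + 1 + (g.φ[q]'hq).length ≤ g.Lx := by
  have := clauseStart_add_length_le g.φ hq; unfold Lx x; exact this

/-- `clauseStart` at `m` is at most `Lx`. [folklore] -/
theorem clauseStart_m_le : clauseStart g.φ g.m ≤ g.Lx := by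
  unfold Lx x m; rw [length_encodeCNFWords]

/-- `getD` of the clause list inside the list. [folklore] -/
theorem getD_clause {q : ℕ} (hq : q < g.m) : g.φ.getD q [] = g.φ[q]'hq :=
  List.getD_eq_getElem _ _ hq

/-! ### The literal loop of one clause -/

/-- The invariant of the literal loop of clause `q` (assignment word `P`, side `side`, row stage
`t₀`, `Lq` literals) after `l` literals; `m₀` is the memory at the start of the row pass (frame
for the registers `≥ 40`). [folklore] -/
structure LitInv (m₀ : ℕ → ℕ) (P : ℕ) (side : Bool) (t₀ q Lq l : ℕ) (mem : ℕ → ℕ) : Prop where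
  regs : g.Regs mem
  eregs : g.ERegs mem
  r30 : mem 30 = P
  r31 : mem 31 = side.toNat
  r32 : mem 32 = g.Bv + t₀
  r20 : mem 20 = g.X + (clauseStart g.φ q + 1 + l)
  r21 : mem 21 = q
  r22 : mem 22 = g.m - q
  r23 : mem 23 = Lq - l
  r25 : mem 25 = (satUpTo g.h P side (g.φ.getD q []) l).toNat
  data : ∀ a, 100 ≤ a → mem a = g.fillData (t₀ + q) a
  frame : ∀ a, 40 ≤ a → a < 100 → mem a = m₀ a

/-- **The literal loop of clause `q`.** [folklore] -/
theorem litLoop_spec (hF : g.Fits W) {m₀ : ℕ → ℕ} {P : ℕ} {side : Bool} {t₀ q : ℕ}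
    (hq : q < g.m) {mem : ℕ → ℕ} (h0 : g.LitInv m₀ P side t₀ q (g.φ[q]'hq).length 0 mem) :
    Achieves W O (whilenz (r 23) litBody) mem
      (g.LitInv m₀ P side t₀ q (g.φ[q]'hq).length (g.φ[q]'hq).length)
      ((g.φ[q]'hq).length * 17 + 1) := by
  obtain ⟨hX, hXLx, hBv, hSv, htop, hNdV, hPwV, hcMV, hmLx, hN1, hPw1, hNN, hNNN, hNd, hdNd, hmd,
    hhn, hnW, hN⟩ := g.facts hF
  set Lq := (g.φ[q]'hq).length with hLq
  have hcs : clauseStart g.φ q + 1 + Lq ≤ g.Lx := g.clauseStart_le hq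
  have hcl : g.φ.getD q [] = g.φ[q]'hq := g.getD_clause hq
  refine Achieves.whilenz Lq 15 (fun l => g.LitInv m₀ P side t₀ q Lq l) (fun l hl m' hI => ⟨?_, ?_⟩)
    (fun m' hI => ?_) h0 (fun _ h => h) (by omega)
  · simp only [Operand.read, hI.r23]; omega
  · obtain ⟨hR, hE, s30, s31, s32, s20, s21, s22, s23, s25, hD, hfr⟩ := hI
    have r4 := hR.r4
    -- the literal read
    set lit : Literal ℕ := (g.φ[q]'hq)[l]'hl with hlit
    have hread : m' (g.X + (clauseStart g.φ q + 1 + l)) = litCode lit := by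
      rw [hD _ (by omega), g.fillData_of_lt_Bv _ (by omega), relocated_X_add, g.x_getD_lit hq hl]
    refine achieves_block_of_eq (fun m'' hm'' => ?_) le_rfl
    simp (disch := first | omega | decide) only [execOps_cons, execOps_nil, execOp, Operand.write,
      Operand.read, merge_apply_of_lt, merge_apply_of_le, update_merge_of_lt,
      Function.update_self, Function.update_of_ne, BinOp.eval_add_of_lt, BinOp.eval_sub_of_le,
      BinOp.eval_band, BinOp.eval_shr, BinOp.eval_lt, BinOp.eval_eq, Nat.and_self, r4, s20, s23,
      s25, s30, s31, hread, CliqueRed.litCode_shiftRight_one, CliqueRed.litCode_and_one,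
      CliqueRed.shiftRight_and_one] at hm''
    subst hm''
    have hstep : (if ((if (satUpTo g.h P side (g.φ.getD q []) l).toNat = 0 then 1 else 0 : ℕ) &&&
        (if (((if (if lit.1 < g.h then 1 else 0 : ℕ) = side.toNat then 1 else 0 : ℕ) &&&
          (if (P.testBit lit.1).toNat = lit.2.toNat then 1 else 0 : ℕ)) = 0) then 1 else 0 : ℕ)) < 1
        then 1 else 0 : ℕ) = (satUpTo g.h P side (g.φ.getD q []) (l + 1)).toNat := by
      rw [litSat_toNat, sat_step, hcl, satUpTo_succ _ _ _ _ hl]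
    refine ⟨hR.of_frame fun c hc => ?_, hE.of_frame fun c hc hc' => ?_, ?_, ?_, ?_, ?_, ?_, ?_, ?_,
      ?_, fun a ha => ?data, fun a ha ha' => ?frame⟩
    case data => rw [merge_apply_of_le ha]; exact hD a ha
    case frame =>
      rw [merge_apply_of_lt ha']
      simp (disch := omega) only [Function.update_of_ne]
      exact hfr a ha ha'
    · rw [merge_apply_of_lt (by omega)]; simp (disch := omega) only [Function.update_of_ne]
    · rw [merge_apply_of_lt (by omega)]; simp (disch := omega) only [Function.update_of_ne]
    all_goals (try simp (disch := first | omega | decide) only [merge_apply_of_lt,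
      Function.update_self, Function.update_of_ne])
    · exact s30
    · exact s31
    · exact s32
    · omega
    · exact s21
    · exact s22
    · omega
    · exact hstep
  · simp only [Operand.read, hI.r23]; omega

/-! ### The clause loop of one row -/

/-- The invariant of the clause loop after `q` clauses. [folklore] -/
structure ClauseInv (m₀ : ℕ → ℕ) (P : ℕ) (side : Bool) (t₀ q : ℕ) (mem : ℕ → ℕ) : Prop where
  regs : g.Regs mem
  eregs : g.ERegs mem
  r30 : mem 30 = P
  r31 : mem 31 = side.toNat
  r32 : mem 32 = g.Bv + t₀
  r20 : mem 20 = g.X + clauseStart g.φ q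
  r21 : mem 21 = q
  r22 : mem 22 = g.m - q
  data : ∀ a, 100 ≤ a → mem a = g.fillData (t₀ + q) a
  frame : ∀ a, 40 ≤ a → a < 100 → mem a = m₀ a

/-- The time of one clause of width `≤ k`. [folklore] -/
def Tcl (k : ℕ) : ℕ := 17 * k + 10

/-- **One clause.** The value written for clause `q` is supplied by the hypothesis `hval` (it is
the emulated cell `t₀ + q`). [folklore] -/
theorem clauseBody_spec (hF : g.Fits W) {k : ℕ} (hw : g.φ.IsWidthLE k) {m₀ : ℕ → ℕ} {P : ℕ}
    {side : Bool} {t₀ : ℕ} (ht₀ : t₀ + g.d ≤ 2 * g.Nd + 3)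
    (hval : ∀ q, q < g.m →
      (if (satW g.φ g.h side P q).toNat = 0 then 1 else 0 : ℕ) % g.Pw = g.ycell (t₀ + q))
    {q : ℕ} (hq : q < g.m) {mem : ℕ → ℕ} (h0 : g.ClauseInv m₀ P side t₀ q mem) :
    Achieves W O clauseBody mem (g.ClauseInv m₀ P side t₀ (q + 1)) (Tcl k) := by
  obtain ⟨hX, hXLx, hBv, hSv, htop, hNdV, hPwV, hcMV, hmLx, hN1, hPw1, hNN, hNNN, hNd, hdNd, hmd,
    hhn, hnW, hN⟩ := g.facts hF
  obtain ⟨hR, hE, s30, s31, s32, s20, s21, s22, hD, hfr⟩ := h0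
  set Lq := (g.φ[q]'hq).length with hLq
  have hLqk : Lq ≤ k := hw _ (List.getElem_mem hq)
  have hcs : clauseStart g.φ q + 1 + Lq ≤ g.Lx := g.clauseStart_le hq
  have hcl : g.φ.getD q [] = g.φ[q]'hq := g.getD_clause hq
  have hread : mem (g.X + clauseStart g.φ q) = Lq := by
    rw [hD _ (by omega), g.fillData_of_lt_Bv _ (by omega), relocated_X_add, g.x_getD_clauseStart hq]
  unfold clauseBody Tcl
  refine Achieves.mono (T := 3 + ((Lq * 17 + 1) + (6 + 0))) ?_ (fun _ h => h) (by omega)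
  refine Achieves.seqs_cons (R := g.LitInv m₀ P side t₀ q Lq 0) ?_ fun m₁ h₁ => ?_
  · have r13 := hE.r13
    refine achieves_block_of_eq (fun m' hm' => ?_) le_rfl
    simp (disch := first | omega | decide) only [execOps_cons, execOps_nil, execOp, Operand.write,
      Operand.read, merge_apply_of_lt, merge_apply_of_le, update_merge_of_lt,
      Function.update_of_ne, BinOp.eval_add_of_lt, BinOp.eval_band, Nat.and_self, s20,
      hread] at hm'
    subst hm'
    refine ⟨hR.of_frame fun c hc => ?_, hE.of_frame fun c hc hc' => ?_, ?_, ?_, ?_, ?_, ?_, ?_, ?_,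
      ?_, fun a ha => ?data, fun a ha ha' => ?frame⟩
    case data => rw [merge_apply_of_le ha]; exact hD a ha
    case frame =>
      rw [merge_apply_of_lt ha']
      simp (disch := omega) only [Function.update_of_ne]
      exact hfr a ha ha'
    · rw [merge_apply_of_lt (by omega)]; simp (disch := omega) only [Function.update_of_ne]
    · rw [merge_apply_of_lt (by omega)]; simp (disch := omega) only [Function.update_of_ne]
    all_goals (try simp (disch := first | omega | decide) only [merge_apply_of_lt,
      Function.update_self, Function.update_of_ne])
    · exact s30
    · exact s31
    · exact s32
    · omega
    · exact s21
    · exact s22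
    · omega
    · rw [satUpTo_zero]; rfl
  refine Achieves.seqs_cons (R := g.LitInv m₀ P side t₀ q Lq Lq) (g.litLoop_spec hF hq h₁)
    fun m₂ h₂ => ?_
  obtain ⟨hR₂, hE₂, u30, u31, u32, u20, u21, u22, u23, u25, uD, ufr⟩ := h₂
  have u13 := hE₂.r13
  refine Achieves.seqs_cons (T₂ := 0) ?_ (fun _ h => Achieves.seqs_nil h)
  refine achieves_block_of_eq (fun m' hm' => ?_) le_rfl
  simp (disch := first | omega | decide) only [execOps_cons, execOps_nil, execOp, Operand.write,
    Operand.read, merge_apply_of_lt, update_merge_of_lt, update_merge_of_le,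
    Function.update_self, Function.update_of_ne, BinOp.eval_add_of_lt, BinOp.eval_sub_of_le,
    BinOp.eval_mod, BinOp.eval_band, BinOp.eval_eq, Nat.and_self, u13, u21, u22, u25, u32] at hm'
  subst hm'
  have hcs' := clauseStart_succ g.φ hq
  have hv : (if (satUpTo g.h P side (g.φ.getD q []) Lq).toNat = 0 then 1 else 0 : ℕ) % g.Pw =
      g.ycell (t₀ + q) := by
    have hLq' : Lq = (g.φ.getD q []).length := by rw [hcl]
    rw [hLq', satUpTo_getD_length]; exact hval q hq
  refine ⟨hR₂.of_frame fun c hc => ?_, hE₂.of_frame fun c hc hc' => ?_, ?_, ?_, ?_, ?_, ?_, ?_,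
    fun a ha => ?data, fun a ha ha' => ?frame⟩
  case data =>
    rw [merge_apply_of_le ha, hv, show g.Bv + t₀ + q = g.Bv + (t₀ + q) by omega,
      show t₀ + (q + 1) = t₀ + q + 1 by omega]
    exact g.fillData_succ uD a ha
  case frame =>
    rw [merge_apply_of_lt ha']
    simp (disch := omega) only [Function.update_of_ne]
    exact ufr a ha ha'
  · rw [merge_apply_of_lt (by omega)]; simp (disch := omega) only [Function.update_of_ne]
  · rw [merge_apply_of_lt (by omega)]; simp (disch := omega) only [Function.update_of_ne]
  all_goals (try simp (disch := first | omega | decide) only [merge_apply_of_lt,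
    Function.update_self, Function.update_of_ne])
  · exact u30
  · exact u31
  · exact u32
  · rw [u20, hcs']
  · omega

/-- The time of the row pass. [folklore] -/
def Trp (k : ℕ) : ℕ := g.m * (Tcl k + 2) + 4

/-- **The row pass.** From the setup registers, the assignment word `P` in `r30`, the side in `r31`,
the row base `Bv + t₀` in `r32` and the data at stage `t₀`, `rowPass` brings the data to stage
`t₀ + m`, keeping the registers `≥ 40`. [folklore] -/
theorem rowPass_spec (hF : g.Fits W) {k : ℕ} (hw : g.φ.IsWidthLE k) {P : ℕ} {side : Bool}
    {t₀ : ℕ} (ht₀ : t₀ + g.d ≤ 2 * g.Nd + 3)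
    (hval : ∀ q, q < g.m →
      (if (satW g.φ g.h side P q).toNat = 0 then 1 else 0 : ℕ) % g.Pw = g.ycell (t₀ + q))
    {mem : ℕ → ℕ} (hR : g.Regs mem) (hE : g.ERegs mem) (h30 : mem 30 = P)
    (h31 : mem 31 = side.toNat) (h32 : mem 32 = g.Bv + t₀)
    (hD : ∀ a, 100 ≤ a → mem a = g.fillData t₀ a) :
    Achieves W O rowPass mem (g.ClauseInv mem P side t₀ g.m) (g.Trp k) := by
  obtain ⟨hX, hXLx, hBv, hSv, htop, hNdV, hPwV, hcMV, hmLx, hN1, hPw1, hNN, hNNN, hNd, hdNd, hmd,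
    hhn, hnW, hN⟩ := g.facts hF
  unfold rowPass Trp
  refine Achieves.mono (T := 3 + ((g.m * (Tcl k + 2) + 1) + 0)) ?_ (fun _ h => h) (by omega)
  refine Achieves.seqs_cons (R := g.ClauseInv mem P side t₀ 0) ?_ fun m₁ h₁ => ?_
  · obtain ⟨r0, r2, r3, r4, r5, r6, r7, r10⟩ := hR
    obtain ⟨r11, r12, r13⟩ := hE
    refine achieves_block_of_eq (fun m' hm' => ?_) le_rfl
    simp (disch := first | omega | decide) only [execOps_cons, execOps_nil, execOp, Operand.write,
      Operand.read, merge_apply_of_lt, update_merge_of_lt, Function.update_of_ne,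
      BinOp.eval_add_of_lt, BinOp.eval_band, Nat.and_self, r0, r3] at hm'
    subst hm'
    have hcs0 := clauseStart_zero g.φ
    refine ⟨⟨?_, ?_, ?_, ?_, ?_, ?_, ?_, ?_⟩, ⟨?_, ?_, ?_⟩, ?_, ?_, ?_, ?_, ?_, ?_, fun a ha => ?data,
      fun a ha ha' => ?frame⟩
    case data => rw [merge_apply_of_le ha, Nat.add_zero]; exact hD a ha
    case frame => rw [merge_apply_of_lt ha']; simp (disch := omega) only [Function.update_of_ne]
    all_goals (try simp (disch := first | omega | decide) only [merge_apply_of_lt,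
      Function.update_self, Function.update_of_ne])
    all_goals first | assumption | omega
  refine Achieves.seqs_cons ?_ (fun _ h => Achieves.seqs_nil h)
  exact Achieves.whilenz g.m (Tcl k) (fun q => g.ClauseInv mem P side t₀ q)
    (fun q hq m' hI => ⟨by simp only [Operand.read, hI.r22]; omega,
      g.clauseBody_spec hF hw ht₀ hval hq hI⟩)
    (fun m' hI => by simp only [Operand.read, hI.r22]; omega) h₁ (fun _ h => h) le_rfl

end Params

end OVRed

end Literature.Computability.FineGrained

namespace Literature.Computability.FineGrained

open Cryptography Cryptography.WordRAM Complexity Cryptography.WordRAM.SProg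

namespace OVRed

open CliqueRed (r pt im lay achieves_block_of_eq)
open SplitList (half satW half_le le_two_mul_half)

namespace Params

variable (g : Params) {W : ℕ} {O : List ℕ → List ℕ}

/-! ### The rows of the two sides -/

/-- The invariant of the row loop of the first side after `p` rows. [folklore] -/
structure RowsAInv (p : ℕ) (mem : ℕ → ℕ) : Prop where
  regs : g.Regs mem
  eregs : g.ERegs mem
  r40 : mem 40 = p
  r41 : mem 41 = g.N - p
  data : ∀ a, 100 ≤ a → mem a = g.fillData (3 + p * g.d) a

/-- The invariant of the row loop of the second side after `p` rows. [folklore] -/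
structure RowsBInv (p : ℕ) (mem : ℕ → ℕ) : Prop where
  regs : g.Regs mem
  eregs : g.ERegs mem
  r40 : mem 40 = p
  r41 : mem 41 = g.N - p
  data : ∀ a, 100 ≤ a → mem a = g.fillData (3 + g.Nd + p * g.d) a

/-- The time of one row. [folklore] -/
def Trow (k : ℕ) : ℕ := g.Trp k + 8

/-- The time of the rows of one side. [folklore] -/
def Trows (k : ℕ) : ℕ := g.N * (g.Trow k + 2) + 3

/-- **The values written in a first-side row** are the emulated cells. [folklore] -/
theorem rowA_val (hF : g.Fits W) {p : ℕ} (hp : p < g.N) (q : ℕ) (hq : q < g.m) :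
    (if (satW g.φ g.h true p q).toNat = 0 then 1 else 0 : ℕ) % g.Pw = g.ycell (3 + p * g.d + q) := by
  have hmd := hF.md
  rw [ite_toNat_eq_zero, show 3 + p * g.d + q = 3 + (p * g.d + q) by omega,
    g.ycell_A hp (by omega), vecBit_of_lt hq]

/-- **The values written in a second-side row** are the emulated cells. [folklore] -/
theorem rowB_val (hF : g.Fits W) {p : ℕ} (hp : p < g.N) (q : ℕ) (hq : q < g.m) :
    (if (satW g.φ g.h false (p * g.N) q).toNat = 0 then 1 else 0 : ℕ) % g.Pw =
      g.ycell (3 + g.Nd + p * g.d + q) := by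
  have hmd := hF.md
  rw [ite_toNat_eq_zero, show 3 + g.Nd + p * g.d + q = 3 + (g.Nd + (p * g.d + q)) by omega,
    g.ycell_B hp (by omega), vecBit_of_lt hq]

/-- **One row of the first side.** [folklore] -/
theorem rowA_spec (hF : g.Fits W) {k : ℕ} (hw : g.φ.IsWidthLE k) {p : ℕ} (hp : p < g.N)
    {mem : ℕ → ℕ} (hI : g.RowsAInv p mem) : Achieves W O rowA mem (g.RowsAInv (p + 1)) (g.Trow k) := by
  obtain ⟨hX, hXLx, hBv, hSv, htop, hNdV, hPwV, hcMV, hmLx, hN1, hPw1, hNN, hNNN, hNd, hdNd, hmd,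
    hhn, hnW, hN⟩ := g.facts hF
  obtain ⟨hR, hE, r40, r41, hD⟩ := hI
  have hpd : p * g.d + g.d ≤ g.Nd := by
    rw [hNd, ← Nat.succ_mul]; exact Nat.mul_le_mul_right _ hp
  unfold rowA Trow
  refine Achieves.mono (T := 5 + (g.Trp k + (2 + 0))) ?_ (fun _ h => h) (by omega)
  refine Achieves.seqs_cons (R := fun m₁ => g.Regs m₁ ∧ g.ERegs m₁ ∧ m₁ 30 = p ∧
      m₁ 31 = Bool.true.toNat ∧ m₁ 32 = g.Bv + (3 + p * g.d) ∧ m₁ 40 = p ∧ m₁ 41 = g.N - p ∧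
      ∀ a, 100 ≤ a → m₁ a = g.fillData (3 + p * g.d) a) ?_ ?_
  · have r6 := hR.r6
    have r10 := hR.r10
    refine achieves_block_of_eq (fun m' hm' => ?_) le_rfl
    simp (disch := first | omega | decide) only [execOps_cons, execOps_nil, execOp, Operand.write,
      Operand.read, merge_apply_of_lt, update_merge_of_lt, Function.update_self,
      Function.update_of_ne, BinOp.eval_add_of_lt, BinOp.eval_mul_of_lt, BinOp.eval_band,
      Nat.and_self, r6, r10, r40] at hm'
    subst hm'
    refine ⟨hR.of_frame fun c hc => ?_, hE.of_frame fun c hc hc' => ?_, ?_, ?_, ?_, ?_, ?_,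
      fun a ha => ?data⟩
    case data => rw [merge_apply_of_le ha]; exact hD a ha
    · rw [merge_apply_of_lt (by omega)]; simp (disch := omega) only [Function.update_of_ne]
    · rw [merge_apply_of_lt (by omega)]; simp (disch := omega) only [Function.update_of_ne]
    all_goals (try simp (disch := first | omega | decide) only [merge_apply_of_lt,
      Function.update_self, Function.update_of_ne])
    · rfl
    · omega
    · exact r40
    · exact r41
  rintro m₁ ⟨hR₁, hE₁, s30, s31, s32, s40, s41, hD₁⟩
  refine Achieves.seqs_cons (g.rowPass_spec hF hw (t₀ := 3 + p * g.d) (by omega)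
    (g.rowA_val hF hp) hR₁ hE₁ s30 s31 s32 hD₁) fun m₂ h₂ => ?_
  obtain ⟨hR₂, hE₂, -, -, -, -, -, -, uD, ufr⟩ := h₂
  have u40 : m₂ 40 = p := by rw [ufr 40 (by omega) (by omega), s40]
  have u41 : m₂ 41 = g.N - p := by rw [ufr 41 (by omega) (by omega), s41]
  refine Achieves.seqs_cons (T₂ := 0) ?_ (fun _ h => Achieves.seqs_nil h)
  refine achieves_block_of_eq (fun m' hm' => ?_) le_rfl
  simp (disch := first | omega | decide) only [execOps_cons, execOps_nil, execOp, Operand.write,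
    Operand.read, merge_apply_of_lt, update_merge_of_lt, Function.update_of_ne,
    BinOp.eval_add_of_lt, BinOp.eval_sub_of_le, u40, u41] at hm'
  subst hm'
  refine ⟨hR₂.of_frame fun c hc => ?_, hE₂.of_frame fun c hc hc' => ?_, ?_, ?_, fun a ha => ?data⟩
  case data =>
    rw [merge_apply_of_le ha, uD a ha, show 3 + p * g.d + g.m = 3 + p * g.d + g.m by rfl]
    exact g.fillData_rowA_done hF hp a
  · rw [merge_apply_of_lt (by omega)]; simp (disch := omega) only [Function.update_of_ne]
  · rw [merge_apply_of_lt (by omega)]; simp (disch := omega) only [Function.update_of_ne]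
  all_goals (try simp (disch := first | omega | decide) only [merge_apply_of_lt,
    Function.update_self, Function.update_of_ne])
  · omega

/-- **The rows of the first side.** [folklore] -/
theorem rowsA_spec (hF : g.Fits W) {k : ℕ} (hw : g.φ.IsWidthLE k) {mem : ℕ → ℕ} (hR : g.Regs mem)
    (hE : g.ERegs mem) (hD : ∀ a, 100 ≤ a → mem a = g.fillData 3 a) :
    Achieves W O rowsA mem (g.RowsAInv g.N) (g.Trows k) := by
  obtain ⟨hX, hXLx, hBv, hSv, htop, hNdV, hPwV, hcMV, hmLx, hN1, hPw1, hNN, hNNN, hNd, hdNd, hmd,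
    hhn, hnW, hN⟩ := g.facts hF
  unfold rowsA Trows
  refine Achieves.mono (T := 2 + ((g.N * (g.Trow k + 2) + 1) + 0)) ?_ (fun _ h => h) (by omega)
  refine Achieves.seqs_cons (R := g.RowsAInv 0) ?_ fun m₁ h₁ => ?_
  · have r5 := hR.r5
    refine achieves_block_of_eq (fun m' hm' => ?_) le_rfl
    simp (disch := first | omega | decide) only [execOps_cons, execOps_nil, execOp, Operand.write,
      Operand.read, merge_apply_of_lt, update_merge_of_lt, Function.update_of_ne, BinOp.eval_band,
      Nat.and_self, r5] at hm'
    subst hm'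
    refine ⟨hR.of_frame fun c hc => ?_, hE.of_frame fun c hc hc' => ?_, ?_, ?_, fun a ha => ?data⟩
    case data => rw [merge_apply_of_le ha, hD a ha, Nat.zero_mul]
    · rw [merge_apply_of_lt (by omega)]; simp (disch := omega) only [Function.update_of_ne]
    · rw [merge_apply_of_lt (by omega)]; simp (disch := omega) only [Function.update_of_ne]
    all_goals (try simp (disch := first | omega | decide) only [merge_apply_of_lt,
      Function.update_self, Function.update_of_ne])
    · omega
  refine Achieves.seqs_cons ?_ (fun _ h => Achieves.seqs_nil h)
  exact Achieves.whilenz g.N (g.Trow k) (fun p => g.RowsAInv p)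
    (fun p hp m' hI => ⟨by simp only [Operand.read, hI.r41]; omega, g.rowA_spec hF hw hp hI⟩)
    (fun m' hI => by simp only [Operand.read, hI.r41]; omega) h₁ (fun _ h => h) le_rfl

/-- **One row of the second side.** [folklore] -/
theorem rowB_spec (hF : g.Fits W) {k : ℕ} (hw : g.φ.IsWidthLE k) {p : ℕ} (hp : p < g.N)
    {mem : ℕ → ℕ} (hI : g.RowsBInv p mem) : Achieves W O rowB mem (g.RowsBInv (p + 1)) (g.Trow k) := by
  obtain ⟨hX, hXLx, hBv, hSv, htop, hNdV, hPwV, hcMV, hmLx, hN1, hPw1, hNN, hNNN, hNd, hdNd, hmd,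
    hhn, hnW, hN⟩ := g.facts hF
  obtain ⟨hR, hE, r40, r41, hD⟩ := hI
  have hpd : p * g.d + g.d ≤ g.Nd := by
    rw [hNd, ← Nat.succ_mul]; exact Nat.mul_le_mul_right _ hp
  have hpN : p * g.N + g.N ≤ g.N * g.N := by
    rw [← Nat.succ_mul]; exact Nat.mul_le_mul_right _ hp
  unfold rowB Trow
  refine Achieves.mono (T := 6 + (g.Trp k + (2 + 0))) ?_ (fun _ h => h) (by omega)
  refine Achieves.seqs_cons (R := fun m₁ => g.Regs m₁ ∧ g.ERegs m₁ ∧ m₁ 30 = p * g.N ∧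
      m₁ 31 = Bool.false.toNat ∧ m₁ 32 = g.Bv + (3 + g.Nd + p * g.d) ∧ m₁ 40 = p ∧
      m₁ 41 = g.N - p ∧ ∀ a, 100 ≤ a → m₁ a = g.fillData (3 + g.Nd + p * g.d) a) ?_ ?_
  · have r5 := hR.r5
    have r6 := hR.r6
    have r7 := hR.r7
    have r10 := hR.r10
    refine achieves_block_of_eq (fun m' hm' => ?_) le_rfl
    simp (disch := first | omega | decide) only [execOps_cons, execOps_nil, execOp, Operand.write,
      Operand.read, merge_apply_of_lt, update_merge_of_lt, Function.update_self,
      Function.update_of_ne, BinOp.eval_add_of_lt, BinOp.eval_mul_of_lt, BinOp.eval_band,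
      Nat.and_self, r5, r6, r7, r10, r40] at hm'
    subst hm'
    refine ⟨hR.of_frame fun c hc => ?_, hE.of_frame fun c hc hc' => ?_, ?_, ?_, ?_, ?_, ?_,
      fun a ha => ?data⟩
    case data => rw [merge_apply_of_le ha]; exact hD a ha
    · rw [merge_apply_of_lt (by omega)]; simp (disch := omega) only [Function.update_of_ne]
    · rw [merge_apply_of_lt (by omega)]; simp (disch := omega) only [Function.update_of_ne]
    all_goals (try simp (disch := first | omega | decide) only [merge_apply_of_lt,
      Function.update_self, Function.update_of_ne])
    · rfl
    · omega
    · exact r40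
    · exact r41
  rintro m₁ ⟨hR₁, hE₁, s30, s31, s32, s40, s41, hD₁⟩
  refine Achieves.seqs_cons (g.rowPass_spec hF hw (t₀ := 3 + g.Nd + p * g.d) (by omega)
    (g.rowB_val hF hp) hR₁ hE₁ s30 s31 s32 hD₁) fun m₂ h₂ => ?_
  obtain ⟨hR₂, hE₂, -, -, -, -, -, -, uD, ufr⟩ := h₂
  have u40 : m₂ 40 = p := by rw [ufr 40 (by omega) (by omega), s40]
  have u41 : m₂ 41 = g.N - p := by rw [ufr 41 (by omega) (by omega), s41]
  refine Achieves.seqs_cons (T₂ := 0) ?_ (fun _ h => Achieves.seqs_nil h)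
  refine achieves_block_of_eq (fun m' hm' => ?_) le_rfl
  simp (disch := first | omega | decide) only [execOps_cons, execOps_nil, execOp, Operand.write,
    Operand.read, merge_apply_of_lt, update_merge_of_lt, Function.update_of_ne,
    BinOp.eval_add_of_lt, BinOp.eval_sub_of_le, u40, u41] at hm'
  subst hm'
  refine ⟨hR₂.of_frame fun c hc => ?_, hE₂.of_frame fun c hc hc' => ?_, ?_, ?_, fun a ha => ?data⟩
  case data =>
    rw [merge_apply_of_le ha, uD a ha]
    exact g.fillData_rowB_done hF hp a
  · rw [merge_apply_of_lt (by omega)]; simp (disch := omega) only [Function.update_of_ne]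
  · rw [merge_apply_of_lt (by omega)]; simp (disch := omega) only [Function.update_of_ne]
  all_goals (try simp (disch := first | omega | decide) only [merge_apply_of_lt,
    Function.update_self, Function.update_of_ne])
  · omega

/-- **The rows of the second side.** [folklore] -/
theorem rowsB_spec (hF : g.Fits W) {k : ℕ} (hw : g.φ.IsWidthLE k) {mem : ℕ → ℕ} (hR : g.Regs mem)
    (hE : g.ERegs mem) (hD : ∀ a, 100 ≤ a → mem a = g.fillData (3 + g.Nd) a) :
    Achieves W O rowsB mem (g.RowsBInv g.N) (g.Trows k) := by
  obtain ⟨hX, hXLx, hBv, hSv, htop, hNdV, hPwV, hcMV, hmLx, hN1, hPw1, hNN, hNNN, hNd, hdNd, hmd,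
    hhn, hnW, hN⟩ := g.facts hF
  unfold rowsB Trows
  refine Achieves.mono (T := 2 + ((g.N * (g.Trow k + 2) + 1) + 0)) ?_ (fun _ h => h) (by omega)
  refine Achieves.seqs_cons (R := g.RowsBInv 0) ?_ fun m₁ h₁ => ?_
  · have r5 := hR.r5
    refine achieves_block_of_eq (fun m' hm' => ?_) le_rfl
    simp (disch := first | omega | decide) only [execOps_cons, execOps_nil, execOp, Operand.write,
      Operand.read, merge_apply_of_lt, update_merge_of_lt, Function.update_of_ne, BinOp.eval_band,
      Nat.and_self, r5] at hm'
    subst hm'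
    refine ⟨hR.of_frame fun c hc => ?_, hE.of_frame fun c hc hc' => ?_, ?_, ?_, fun a ha => ?data⟩
    case data => rw [merge_apply_of_le ha, hD a ha, Nat.zero_mul, Nat.add_zero]
    · rw [merge_apply_of_lt (by omega)]; simp (disch := omega) only [Function.update_of_ne]
    · rw [merge_apply_of_lt (by omega)]; simp (disch := omega) only [Function.update_of_ne]
    all_goals (try simp (disch := first | omega | decide) only [merge_apply_of_lt,
      Function.update_self, Function.update_of_ne])
    · omega
  refine Achieves.seqs_cons ?_ (fun _ h => Achieves.seqs_nil h)
  exact Achieves.whilenz g.N (g.Trow k) (fun p => g.RowsBInv p)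
    (fun p hp m' hI => ⟨by simp only [Operand.read, hI.r41]; omega, g.rowB_spec hF hw hp hI⟩)
    (fun m' hI => by simp only [Operand.read, hI.r41]; omega) h₁ (fun _ h => h) le_rfl

/-! ### The whole build -/

/-- The time of the build (width `≤ k`). [folklore] -/
def Tpre (k : ℕ) : ℕ :=
  7 * g.Lx + 14 + (Nat.size (2 * g.Nd + 2) * 4 + 1) + 16 + 10 + g.Trows k + g.Trows k + 96

/-- **The build.** On the initial memory of the input `x = encodeCNFWords φ` (word size `W` with
`g.Fits W`, width `≤ k`), `pre` ends, within `Tpre k` steps, in the closed-form memory `finMem`: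
environment registers `Bv, Sv, 0, Pw`, all other registers `0`, and the data `finData` (relocated
input and the emulated OV input). [folklore] -/
theorem pre_spec (hF : g.Fits W) {k : ℕ} (hw : g.φ.IsWidthLE k) :
    Achieves W O (pre g.c g.kM g.cM) (initFun g.x) (fun mem => mem = g.finMem) (g.Tpre k) := by
  obtain ⟨hX, hXLx, hBv, hSv, htop, hNdV, hPwV, hcMV, hmLx, hN1, hPw1, hNN, hNNN, hNd, hdNd, hmd,
    hhn, hnW, hN⟩ := g.facts hF
  unfold pre Tpre
  refine Achieves.mono (T := 7 * g.Lx + (14 + ((Nat.size (2 * g.Nd + 2) * 4 + 1) + (16 +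
    (10 + (g.Trows k + (g.Trows k + (96 + 0)))))))) ?_ (fun _ h => h) (by omega)
  -- relocate
  refine Achieves.seqs_cons (R := fun mem => mem = relocated g.x) (T₁ := 7 * g.Lx)
    (fun qs => ⟨relocated g.x, 7 * g.Lx, le_rfl, ?_, rfl⟩) ?_
  · have h2 := g.two_le_Lx
    unfold Lx at h2
    exact relocate_exec (by omega) hF.input (by unfold Lx at hXLx hBv; omega) qs
  rintro mem rfl
  -- setup
  refine Achieves.seqs_cons (g.setup1_spec hF) ?_
  rintro m₁ ⟨hR₁, -, h21, h22, hD₁⟩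
  refine Achieves.seqs_cons (CliqueRed.Params.sizeLoop_spec (O := O) h21 h22 (by omega)) ?_
  rintro m₂ ⟨s22, -, sf⟩
  have hR₂ : g.Regs m₂ := hR₁.of_frame fun a ha => sf a (by omega) (by omega)
  have hD₂ : ∀ a, 100 ≤ a → m₂ a = relocated g.x a := fun a ha => by
    rw [sf a (by omega) (by omega), hD₁ a ha]
  refine Achieves.seqs_cons (g.setup3_spec hF hR₂ s22 hD₂) ?_
  rintro m₃ ⟨hR₃, hE₃, hD₃⟩
  -- header, rows
  refine Achieves.seqs_cons (g.header_spec hF hR₃ hE₃ hD₃) ?_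
  rintro m₄ ⟨hR₄, hE₄, hD₄⟩
  refine Achieves.seqs_cons (g.rowsA_spec hF hw hR₄ hE₄ hD₄) fun m₅ h₅ => ?_
  obtain ⟨hR₅, hE₅, -, -, hD₅⟩ := h₅
  have hD₅' : ∀ a, 100 ≤ a → m₅ a = g.fillData (3 + g.Nd) a := fun a ha => by
    rw [hD₅ a ha, hNd, Nat.mul_comm]
  refine Achieves.seqs_cons (g.rowsB_spec hF hw hR₅ hE₅ hD₅') fun m₆ h₆ => ?_
  obtain ⟨hR₆, hE₆, -, -, hD₆⟩ := h₆
  have hD₆' : ∀ a, 100 ≤ a → m₆ a = g.finData a := fun a ha => by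
    rw [hD₆ a ha, ← g.fillData_top a, hNd, show 3 + g.N * g.d + g.N * g.d = 2 * (g.N * g.d) + 3
      by ring]
  -- clearing
  refine Achieves.seqs_cons (T₁ := 96) (T₂ := 0) ?_ fun _ h => Achieves.seqs_nil h
  refine Achieves.block ?_ (by rw [List.length_map, CliqueRed.length_clearedRegs])
  show execOps W m₆ (CliqueRed.clearedRegs.map fun i => ((.band, r i, im 0, im 0) : OpSpec)) =
    g.finMem
  rw [CliqueRed.execOps_clear]
  funext a
  unfold finMem
  simp only [CliqueRed.mem_clearedRegs]
  by_cases ha : a < 100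
  · rw [if_pos ha]
    by_cases h10 : a = 10; · subst h10; simp [hR₆.r10]
    by_cases h11 : a = 11; · subst h11; simp [hE₆.r11]
    by_cases h12 : a = 12; · subst h12; simp [hE₆.r12]
    by_cases h13 : a = 13; · subst h13; simp [hE₆.r13]
    rw [if_pos ⟨ha, by omega⟩, if_neg h10, if_neg h11, if_neg h13]
  · rw [if_neg (by omega), if_neg ha, hD₆' a (by omega)]

end Params

end OVRed

end Literature.Computability.FineGrained
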